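import Literature.AnabelianGeometry.AbsoluteAnabelian.ZHatCompletionFreeProcyclic
import HarnessLib

/-!
# `Ẑ` is `M`-adically separated and complete: `Ẑ ⥲ lim_{M ∈ (ℕ≥1, ∣)} Ẑ/Ẑ^M`

Classical profinite group theory, proof-only (no definitions), over Mathlib's profinite completion
`Ẑ := ProfiniteGrp.ProfiniteCompletion.completion (GrpCat.of (Multiplicative ℤ))` — the term behind the
tree's `Literature.AnabelianGeometry.SemiGraphs.ZHat` and `Literature.IUT.HodgeTheaters.ZHat` (both `abbrev`s).
The abc-iut cell needs, for [IUTchII] Prop. 1.5 (iii) (kurims p. 29, "a projective limit exterior cyclotome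
`Π_μ(M^Θ_*)` … equipped with a uniquely determined cyclotomic rigidity isomorphism
`(l·Δ_Θ)(M^Θ_*) ⥲ Π_μ(M^Θ_*)`"; sub-DAG `plan/L6/SUBDAG-IUTchII-Prop-15.md` row `Prop-15.iii.L03`), the passage to
the limit over `M ∈ (ℕ_{≥1}, ∣)` of the mod-`M` isomorphisms `(l·Δ_Θ) ⊗ ℤ/Mℤ ⥲ μ_M`, where `l·Δ_Θ ≅ Ẑ` abstractly:
the map `Ẑ → lim_M Ẑ/Ẑ^M` is bijective. We prove it in a TRANSPORT-READY form, for ANY group `G` with a bare group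
isomorphism `G ≃* Ẑ` and ANY system of level homomorphisms `f_M : G →* P_M` whose kernels are exactly the `M`-th
powers, with transition maps `t_{M,M'} : P_{M'} → P_M` (`M ∣ M'`) satisfying `t ∘ f_{M'} = f_M`:

* `ZHatCompletion.mul_comm` — `Ẑ` is commutative;
* `ZHatCompletion.eq_one_of_forall_exists_pow_eq` — SEPARATEDNESS: an element of `Ẑ` that is an `n`-th power
  for every `n ≥ 1` is trivial (through `Ẑ ≃ₜ* ∏_p ℤ_p` of `ZHatCompletionFreeProcyclic` and
  `PadicInt.ext_of_toZModPow`);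
* `ZHatCompletion.isClosed_range_pow` — the set of `n`-th powers is closed (continuous image of a compact);
* `ZHatCompletion.exists_eq_of_compatible` — COMPLETENESS: every family `(c_M)_M`, `c_M ∈ f_M(Ẑ)`, compatible
  under the transitions is of the form `(f_M(x))_M` (Cantor's intersection theorem in the compact group `Ẑ`:
  the fibres `f_M⁻¹(c_M)` are translates of the closed set of `M`-th powers, directed under `∣`);
* `ZHatCompletion.eq_one_of_forall_map_eq_one` — injectivity of `x ↦ (f_M(x))_M`;
* `…_of_mulEquiv` versions for any `G ≃* Ẑ`, and `ZHatCompletion.mem_normalClosure_range_pow_iff[_of_mulEquiv]`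
  — in such a `G` the normal closure of the `n`-th powers (the kernel of the tree's `ModPow G n`) IS the set
  of `n`-th powers.

[cite: RibesZalesskii2010, Thm 2.7.1]. HONEST FRAMING: classical bricks; nothing here bears on [IUTchIII]
Cor. 3.12; no side is taken on any disputed claim; typed ≠ proved elsewhere.
-/

noncomputable section

open CategoryTheory ProfiniteGrp ProfiniteGrp.ProfiniteCompletion Topology

namespace Literature.AnabelianGeometry.AbsoluteAnabelian

/-! ### Commutativity and separatedness -/

/-- **`Ẑ` is commutative** (transport from `∏_p ℤ_p`). [cite: RibesZalesskii2010, Thm 2.7.1] -/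
theorem ZHatCompletion.mul_comm (x y : completion (GrpCat.of (Multiplicative ℤ))) : x * y = y * x := by
  obtain ⟨e, -⟩ := ZHatCompletion.exists_continuousMulEquiv_padicProd
  apply e.injective
  rw [map_mul, map_mul, _root_.mul_comm]

/-- **`Ẑ` is `M`-adically separated**: an element of `Ẑ` which is an `n`-th power for every `n ≥ 1` is
trivial (`⋂_{n ≥ 1} Ẑ^n = {1}`; through `Ẑ ≃ₜ* ∏_p ℤ_p`: a `p^k`-th power for every `k` has `p`-component in
`⋂_k p^k ℤ_p = 0`). [cite: RibesZalesskii2010, Thm 2.7.1] -/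
theorem ZHatCompletion.eq_one_of_forall_exists_pow_eq {x : completion (GrpCat.of (Multiplicative ℤ))}
    (h : ∀ n : ℕ, 0 < n → ∃ y : completion (GrpCat.of (Multiplicative ℤ)), y ^ n = x) : x = 1 := by
  obtain ⟨e, -⟩ := ZHatCompletion.exists_continuousMulEquiv_padicProd
  have ha : Multiplicative.toAdd (e x) = 0 := by
    funext q
    haveI : Fact (Nat.Prime (q : ℕ)) := ⟨q.2⟩
    refine (PadicInt.ext_of_toZModPow).1 fun k => ?_
    rw [Pi.zero_apply, map_zero]
    obtain ⟨y, hy⟩ := h ((q : ℕ) ^ k) (pow_pos q.2.pos k)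
    have h1 : Multiplicative.toAdd (e x) q =
        ((q : ℕ) ^ k : ℕ) • Multiplicative.toAdd (e y) q := by
      rw [← hy, map_pow, toAdd_pow, Pi.smul_apply]
    rw [h1, nsmul_eq_mul, ← RingHom.mem_ker, PadicInt.ker_toZModPow, Nat.cast_pow]
    exact Ideal.mul_mem_right _ _ (Ideal.mem_span_singleton_self _)
  have h5 : e x = 1 := by
    rw [← ofAdd_toAdd (e x), ha]
    rfl
  exact e.injective (h5.trans (map_one e).symm)

/-- The set of `n`-th powers is CLOSED in `Ẑ` (the continuous image `y ↦ y^n` of the compact space `Ẑ`).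
[cite: RibesZalesskii2010, Thm 2.7.1] -/
theorem ZHatCompletion.isClosed_range_pow (n : ℕ) :
    IsClosed (Set.range fun y : completion (GrpCat.of (Multiplicative ℤ)) => y ^ n) :=
  (isCompact_range (continuous_pow n)).isClosed

/-! ### Completeness: compatible families of classes modulo `M`-th powers are represented -/

section Levels

universe v

variable {P : ℕ+ → Type v} [∀ M, Group (P M)]

/-- **`Ẑ` is `M`-adically complete (Cantor intersection).** Let `f_M : Ẑ →* P_M` (`M ∈ ℕ_{≥1}`) be
homomorphisms whose kernels are exactly the `M`-th powers, and `t_{M,M'} : P_{M'} → P_M` (`M ∣ M'`) maps with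
`t_{M,M'} ∘ f_{M'} = f_M`. Then every family `(c_M)_M` with `c_M ∈ f_M(Ẑ)` and `t_{M,M'}(c_{M'}) = c_M` is
`(f_M(x))_M` for some `x ∈ Ẑ`: the fibres `{x | f_M(x) = c_M}` are translates of the closed set of `M`-th
powers, nonempty, and directed under divisibility, so they have a common point in the compact space `Ẑ`.
[cite: RibesZalesskii2010, Thm 2.7.1] -/
theorem ZHatCompletion.exists_eq_of_compatible
    (f : ∀ M : ℕ+, completion (GrpCat.of (Multiplicative ℤ)) →* P M)
    (hker : ∀ (M : ℕ+) (x : completion (GrpCat.of (Multiplicative ℤ))),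
      f M x = 1 ↔ ∃ y : completion (GrpCat.of (Multiplicative ℤ)), y ^ (M : ℕ) = x)
    (t : ∀ (M M' : ℕ+), (M : ℕ) ∣ (M' : ℕ) → P M' → P M)
    (ht : ∀ (M M' : ℕ+) (h : (M : ℕ) ∣ (M' : ℕ)) (x : completion (GrpCat.of (Multiplicative ℤ))),
      t M M' h (f M' x) = f M x)
    {c : ∀ M : ℕ+, P M} (hc : ∀ M, c M ∈ Set.range (f M))
    (hcompat : ∀ (M M' : ℕ+) (h : (M : ℕ) ∣ (M' : ℕ)), t M M' h (c M') = c M) :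
    ∃ x : completion (GrpCat.of (Multiplicative ℤ)), ∀ M, f M x = c M := by
  let F : ℕ+ → Set (completion (GrpCat.of (Multiplicative ℤ))) := fun M => {x | f M x = c M}
  have hF : ∀ M, ∃ x₀, f M x₀ = c M ∧
      F M = (Homeomorph.mulLeft x₀) ''
        Set.range (fun y : completion (GrpCat.of (Multiplicative ℤ)) => y ^ (M : ℕ)) := by
    intro M
    obtain ⟨x₀, hx₀⟩ := hc M
    refine ⟨x₀, hx₀, ?_⟩
    ext x
    constructor
    · intro hx
      have hx' : f M x = c M := hx
      have h1 : f M (x₀⁻¹ * x) = 1 := by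
        rw [map_mul, map_inv, hx₀, hx', inv_mul_cancel]
      obtain ⟨y, hy⟩ := (hker M _).1 h1
      refine ⟨x₀⁻¹ * x, ⟨y, hy⟩, ?_⟩
      rw [Homeomorph.coe_mulLeft]
      exact mul_inv_cancel_left x₀ x
    · rintro ⟨_, ⟨y, rfl⟩, rfl⟩
      show f M (x₀ * y ^ (M : ℕ)) = c M
      rw [map_mul, (hker M _).2 ⟨y, rfl⟩, mul_one, hx₀]
  have hne : ∀ M, (F M).Nonempty := fun M => by
    obtain ⟨x₀, hx₀, -⟩ := hF M
    exact ⟨x₀, hx₀⟩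
  have hclosed : ∀ M, IsClosed (F M) := fun M => by
    obtain ⟨x₀, -, hF'⟩ := hF M
    rw [hF', Homeomorph.isClosed_image]
    exact ZHatCompletion.isClosed_range_pow (M : ℕ)
  have hcpt : ∀ M, IsCompact (F M) := fun M => (hclosed M).isCompact
  have hdir : Directed (· ⊇ ·) F := by
    intro M₁ M₂
    have h₁ : (M₁ : ℕ) ∣ ((M₁ * M₂ : ℕ+) : ℕ) := by
      rw [PNat.mul_coe]
      exact dvd_mul_right _ _
    have h₂ : (M₂ : ℕ) ∣ ((M₁ * M₂ : ℕ+) : ℕ) := by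
      rw [PNat.mul_coe]
      exact dvd_mul_left _ _
    refine ⟨M₁ * M₂, fun x hx => ?_, fun x hx => ?_⟩
    · have hx' : f (M₁ * M₂) x = c (M₁ * M₂) := hx
      show f M₁ x = c M₁
      rw [← ht M₁ (M₁ * M₂) h₁ x, hx', hcompat M₁ (M₁ * M₂) h₁]
    · have hx' : f (M₁ * M₂) x = c (M₁ * M₂) := hx
      show f M₂ x = c M₂
      rw [← ht M₂ (M₁ * M₂) h₂ x, hx', hcompat M₂ (M₁ * M₂) h₂]
  obtain ⟨x, hx⟩ :=
    IsCompact.nonempty_iInter_of_directed_nonempty_isCompact_isClosed F hdir hne hcpt hclosed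
  exact ⟨x, fun M => Set.mem_iInter.1 hx M⟩

/-- **Injectivity of `Ẑ → lim_M P_M`**: with level homomorphisms `f_M` whose kernels are the `M`-th powers,
`f_M(x) = 1` for all `M` forces `x = 1` (separatedness). [cite: RibesZalesskii2010, Thm 2.7.1] -/
theorem ZHatCompletion.eq_one_of_forall_map_eq_one
    (f : ∀ M : ℕ+, completion (GrpCat.of (Multiplicative ℤ)) →* P M)
    (hker : ∀ (M : ℕ+) (x : completion (GrpCat.of (Multiplicative ℤ))),
      f M x = 1 ↔ ∃ y : completion (GrpCat.of (Multiplicative ℤ)), y ^ (M : ℕ) = x)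
    {x : completion (GrpCat.of (Multiplicative ℤ))} (hx : ∀ M : ℕ+, f M x = 1) : x = 1 :=
  ZHatCompletion.eq_one_of_forall_exists_pow_eq fun n hn => (hker ⟨n, hn⟩ x).1 (hx ⟨n, hn⟩)

end Levels

/-! ### Transport to any group abstractly isomorphic to `Ẑ` -/

section Transport

universe u v

variable {G : Type u} [Group G]

/-- A group abstractly isomorphic to `Ẑ` is commutative. [cite: RibesZalesskii2010, Thm 2.7.1] -/
theorem ZHatCompletion.mul_comm_of_mulEquiv (e : G ≃* completion (GrpCat.of (Multiplicative ℤ)))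
    (a b : G) : a * b = b * a :=
  e.injective (by rw [map_mul, map_mul, ZHatCompletion.mul_comm])

/-- Separatedness, transported: in a group `G ≃* Ẑ`, an element that is an `n`-th power for every `n ≥ 1`
is trivial. [cite: RibesZalesskii2010, Thm 2.7.1] -/
theorem ZHatCompletion.eq_one_of_forall_exists_pow_eq_of_mulEquiv
    (e : G ≃* completion (GrpCat.of (Multiplicative ℤ))) {a : G}
    (h : ∀ n : ℕ, 0 < n → ∃ b : G, b ^ n = a) : a = 1 := by
  apply e.injective
  rw [map_one]
  exact ZHatCompletion.eq_one_of_forall_exists_pow_eq fun n hn => by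
    obtain ⟨b, hb⟩ := h n hn
    exact ⟨e b, by rw [← map_pow, hb]⟩

variable {P : ℕ+ → Type v} [∀ M, Group (P M)]

/-- **Injectivity of `G → lim_M P_M` for `G ≃* Ẑ`** (level homomorphisms with kernels the `M`-th powers).
[cite: RibesZalesskii2010, Thm 2.7.1] -/
theorem ZHatCompletion.eq_one_of_forall_map_eq_one_of_mulEquiv
    (e : G ≃* completion (GrpCat.of (Multiplicative ℤ)))
    (f : ∀ M : ℕ+, G →* P M)
    (hker : ∀ (M : ℕ+) (a : G), f M a = 1 ↔ ∃ b : G, b ^ (M : ℕ) = a)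
    {a : G} (ha : ∀ M : ℕ+, f M a = 1) : a = 1 :=
  ZHatCompletion.eq_one_of_forall_exists_pow_eq_of_mulEquiv e fun n hn =>
    (hker ⟨n, hn⟩ a).1 (ha ⟨n, hn⟩)

/-- **Surjectivity of `G → lim_M P_M` onto compatible families, for `G ≃* Ẑ`** (level homomorphisms with
kernels the `M`-th powers and transitions `t_{M,M'} ∘ f_{M'} = f_M`): every compatible family of values is
represented by one element of `G`. [cite: RibesZalesskii2010, Thm 2.7.1] -/
theorem ZHatCompletion.exists_eq_of_compatible_of_mulEquiv
    (e : G ≃* completion (GrpCat.of (Multiplicative ℤ)))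
    (f : ∀ M : ℕ+, G →* P M)
    (hker : ∀ (M : ℕ+) (a : G), f M a = 1 ↔ ∃ b : G, b ^ (M : ℕ) = a)
    (t : ∀ (M M' : ℕ+), (M : ℕ) ∣ (M' : ℕ) → P M' → P M)
    (ht : ∀ (M M' : ℕ+) (h : (M : ℕ) ∣ (M' : ℕ)) (a : G), t M M' h (f M' a) = f M a)
    {c : ∀ M : ℕ+, P M} (hc : ∀ M, c M ∈ Set.range (f M))
    (hcompat : ∀ (M M' : ℕ+) (h : (M : ℕ) ∣ (M' : ℕ)), t M M' h (c M') = c M) :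
    ∃ a : G, ∀ M, f M a = c M := by
  have hker' : ∀ (M : ℕ+) (x : completion (GrpCat.of (Multiplicative ℤ))),
      (f M).comp e.symm.toMonoidHom x = 1 ↔
        ∃ y : completion (GrpCat.of (Multiplicative ℤ)), y ^ (M : ℕ) = x := by
    intro M x
    rw [MonoidHom.comp_apply, MulEquiv.coe_toMonoidHom, hker]
    constructor
    · rintro ⟨b, hb⟩
      exact ⟨e b, by rw [← map_pow, hb, MulEquiv.apply_symm_apply]⟩
    · rintro ⟨y, hy⟩
      exact ⟨e.symm y, by rw [← map_pow, hy]⟩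
  have ht' : ∀ (M M' : ℕ+) (h : (M : ℕ) ∣ (M' : ℕ)) (x : completion (GrpCat.of (Multiplicative ℤ))),
      t M M' h ((f M').comp e.symm.toMonoidHom x) = (f M).comp e.symm.toMonoidHom x :=
    fun M M' h x => ht M M' h (e.symm x)
  have hc' : ∀ M, c M ∈ Set.range ((f M).comp e.symm.toMonoidHom) := fun M => by
    obtain ⟨a, ha⟩ := hc M
    exact ⟨e a, by rw [MonoidHom.comp_apply, MulEquiv.coe_toMonoidHom, MulEquiv.symm_apply_apply, ha]⟩
  obtain ⟨x, hx⟩ := ZHatCompletion.exists_eq_of_compatible (fun M => (f M).comp e.symm.toMonoidHom)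
    hker' t ht' hc' hcompat
  exact ⟨e.symm x, hx⟩

/-- **Bijectivity package**: for `G ≃* Ẑ` and a level system as above whose level maps are SURJECTIVE, the map
`a ↦ (f_M(a))_M` is injective, and its image is exactly the set of families compatible under the transitions.
[cite: RibesZalesskii2010, Thm 2.7.1] -/
theorem ZHatCompletion.injective_and_range_eq_of_mulEquiv
    (e : G ≃* completion (GrpCat.of (Multiplicative ℤ)))
    (f : ∀ M : ℕ+, G →* P M)
    (hker : ∀ (M : ℕ+) (a : G), f M a = 1 ↔ ∃ b : G, b ^ (M : ℕ) = a)
    (hsurj : ∀ M : ℕ+, Function.Surjective (f M))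
    (t : ∀ (M M' : ℕ+), (M : ℕ) ∣ (M' : ℕ) → P M' → P M)
    (ht : ∀ (M M' : ℕ+) (h : (M : ℕ) ∣ (M' : ℕ)) (a : G), t M M' h (f M' a) = f M a) :
    Function.Injective (fun a : G => fun M : ℕ+ => f M a) ∧
      Set.range (fun a : G => fun M : ℕ+ => f M a) =
        {c | ∀ (M M' : ℕ+) (h : (M : ℕ) ∣ (M' : ℕ)), t M M' h (c M') = c M} := by
  refine ⟨fun a b hab => ?_, Set.Subset.antisymm ?_ ?_⟩
  · have h1 : ∀ M : ℕ+, f M (a * b⁻¹) = 1 := fun M => by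
      have h2 : f M a = f M b := congrFun hab M
      rw [map_mul, map_inv, h2, mul_inv_cancel]
    rw [← mul_inv_eq_one]
    exact ZHatCompletion.eq_one_of_forall_map_eq_one_of_mulEquiv e f hker h1
  · rintro _ ⟨a, rfl⟩ M M' h
    exact ht M M' h a
  · intro c hc
    obtain ⟨a, ha⟩ := ZHatCompletion.exists_eq_of_compatible_of_mulEquiv e f hker t ht
      (fun M => hsurj M (c M)) hc
    exact ⟨a, funext ha⟩

end Transport

/-! ### The kernel of `ModPow`: the normal closure of the `n`-th powers IS the set of `n`-th powers -/

section NormalClosure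

universe u

variable {G : Type u} [Group G]

/-- In a commutative group (commutativity as a `Prop`, the instance being only `Group` — the situation of
the tree's subquotient carriers), the normal closure of the `n`-th powers, i.e. the kernel of the reduction
`G → ModPow G n = G ⧸ normalClosure {a^n}` of [IUTchII] Def. 1.1 (ii), consists exactly of the `n`-th powers.
[cite: RibesZalesskii2010, Thm 2.7.1] -/
theorem ZHatCompletion.mem_normalClosure_range_pow_iff (hcomm : ∀ a b : G, a * b = b * a) (n : ℕ) (a : G) :
    a ∈ Subgroup.normalClosure (Set.range fun b : G => b ^ n) ↔ ∃ b : G, b ^ n = a := by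
  let H : Subgroup G :=
    { carrier := {a | ∃ b : G, b ^ n = a}
      one_mem' := ⟨1, one_pow n⟩
      mul_mem' := by
        rintro _ _ ⟨b₁, rfl⟩ ⟨b₂, rfl⟩
        exact ⟨b₁ * b₂, Commute.mul_pow (hcomm b₁ b₂) n⟩
      inv_mem' := by
        rintro _ ⟨b, rfl⟩
        exact ⟨b⁻¹, inv_pow b n⟩ }
  haveI : H.Normal := ⟨by
    rintro _ ⟨b, rfl⟩ g
    refine ⟨b, ?_⟩
    rw [hcomm g, mul_assoc, mul_inv_cancel, mul_one]⟩
  constructor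
  · intro ha
    have hle : Subgroup.normalClosure (Set.range fun b : G => b ^ n) ≤ H :=
      Subgroup.normalClosure_le_normal (by
        rintro _ ⟨b, rfl⟩
        exact ⟨b, rfl⟩)
    exact hle ha
  · rintro ⟨b, rfl⟩
    exact Subgroup.subset_normalClosure ⟨b, rfl⟩

/-- The same for a group abstractly isomorphic to `Ẑ` (commutativity transported).
[cite: RibesZalesskii2010, Thm 2.7.1] -/
theorem ZHatCompletion.mem_normalClosure_range_pow_iff_of_mulEquiv
    (e : G ≃* completion (GrpCat.of (Multiplicative ℤ))) (n : ℕ) (a : G) :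
    a ∈ Subgroup.normalClosure (Set.range fun b : G => b ^ n) ↔ ∃ b : G, b ^ n = a :=
  ZHatCompletion.mem_normalClosure_range_pow_iff (ZHatCompletion.mul_comm_of_mulEquiv e) n a

end NormalClosure

end Literature.AnabelianGeometry.AbsoluteAnabelian

end
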